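import Summits.BirchSwinnertonDyer.BirchSwinnertonDyer.Theorems.EisensteinPrimesMazurMCOnCellBKernelCertP13DoorPriceClassII
import Summits.BirchSwinnertonDyer.BirchSwinnertonDyer.Theorems.EisensteinPrimesMazurMCOnCellBKernelCertP13DoorPriceSharp
import Literature.NumberTheory.QuadraticFields.FundamentalDiscriminant
import Literature.NumberTheory.EllipticCurves.HeegnerHypothesisKroneckerProofs
import Literature.NumberTheory.EllipticCurves.IsogenyQuadraticTwistProofs
import Literature.NumberTheory.EllipticCurves.NonvanishingTwistsWaldspurgerOfHoffsteinLuo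
import Summits.BirchSwinnertonDyer.BirchSwinnertonDyer.Theorems.AdditiveBranchIMCGenusGrossZagierFourthCurveM
import HarnessLib

/-!
# Crux 3 `MazurMCOnCellB` (stmt-BirchSwinnertonDyer-19033) — the `p = 13` slice: NO REVERSE TWO-STEP EDGE INTO THE CLASS OF AN A10-TYPE CELL AT `13`, part I
# (the engine + cell g19). For EVERY curve `W₁` isogenous to the displayed `E` (granted modularity) and EVERY `U`: `¬ TwoStepAt 13 U W₁` — the zig-zag of
# twistback 6⁷'s left door `…_of_connectedClassShaUnit` can only START with a FORWARD edge (priced in `…DoorPrice*`: `d ≤ −B`, conductor `≥ 9.1·10¹⁴`)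

Width seat bsd-line-x2-p1-w6 (gen 22), cell `bsd-eis` (run/shared/lean/pub/bsd-eis/), 2026-08-30; `--supports stmt-BirchSwinnertonDyer-19033 --as helper`.
THEOREMS ONLY (no `def`, no named fact, no `sorry`, no instance). Registered line `twistback` v13b is NOT touched; nothing here closes a stub.

WHY / WHAT IS NEW. `…DoorPriceClassI/II` (w6 g21, p766256/p766650) priced a REVERSE edge `TwoStepAt 13 U W₁` INTO the class at residue level only (second
field `K″` with `d_{K″} ≤ −B′`, `B′ ∈ {103, …, 1167}`), and memo `P13-DESCENT-ATLAS-w6g21.md` §1.5 named «least reverse fields» `ℚ(√−1095)` (cell A,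
«untwists 5»), `ℚ(√−615)` (#13), … . THE MISSED CONSTRAINT: `K″` is Heegner for `N_{Wd}` (the middle curve, `W₁ ≅ Wd ⊗ χ_{d_{K″}}`), so a prime
`q ∣ d_{K″}` does NOT divide `N_{Wd}` (`SatisfiesHeegnerHypothesis.not_dvd_discr`: a split prime is unramified), i.e. `Wd` is GOOD at `q`; and the twist
of a good curve by a character RAMIFIED at `q` (odd, `q ∥ d_{K″}` — an odd fundamental discriminant is squarefree) is ADDITIVE at `q`
(`hasAdditiveReductionAt_quadraticTwist_of_dvd`, conductor exponent `≥ 2`, `two_le_conductorExponent_iff`), so `q² ∣ N_{W₁} = N_E`. Hence `d_{K″}` is a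
(negative, odd, fundamental) product of ADDITIVE odd primes of `E` — a FINITE candidate set — on top of g21's residue conditions (`2`, `13` and every bad
prime `q ∤ d_{K″}` split in `K″`). So `ℚ(√−1095) = ℚ(√(−3·5·73))` is NOT admissible at cell A (`3, 73 ∤ N_E`), etc.; the enumeration is EMPTY at
11 of the 13 A10-type cells at 13 on record, and equals `{−8207}` (cell X = #12) resp. `{−9831}` (cell Y = #13), both killed by the prime `29`
(`E ⊗ χ_{−8207}` resp. `E ⊗ χ_{−9831}` is still ADDITIVE at `29` — Kodaira III*/III —, certified on an explicit globally minimal model; part IV).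
RESULT (parts I–IV): at all 13 cells, from both displayed vertices `E, E′` UNCONDITIONALLY, and from every `W₁ ∼ E` granted modularity:
`∀ U, ¬ TwoStepAt 13 U W₁`. Consequence for 6⁷ at these cells (with `…DoorPrice*`): every zig-zag of the left door out of the class begins with a
FORWARD edge, whose first datum is an analytic-rank-one reading at conductor `N_E·B² ≥ 9.1·10¹⁴` (cell S) — g21's «reverse edge at 4.3·10¹⁴» does not exist.

HOW. §0: `sq_dvd_conductorNorm_of_dvd_discr` (the constraint above); `prod_filter_dvd_eq` (a squarefree `n` whose prime factors lie in a nodup list `ps`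
of primes is the product of the sublist of `ps` dividing it); `exists_variableChange_twist_back` (`C • W = Wd ⊗ χ_d ⇒ C′ • Wd = W ⊗ χ_d`, from
`quadraticTwist_smul`, `quadraticTwist_quadraticTwist`, `exists_variableChange_quadraticTwist_one/_mul_sq`); the engine `exists_sublist_of_twoStepAt_into`
unfolds a reverse edge into: a sublist `S` of the odd bad primes with `d_{K″} = −∏S`, `∏S > 4`, `−∏S ≡ 1 (mod 8)`, `(−∏S / 13) = 1`, `q ∣ ∏S ∨ (−∏S / q) = 1`
for every odd bad `q`, no multiplicative prime in `S` (exponent-one primes: `GenusGrossZagier.not_sq_dvd_conductorNorm_of_mult`), and a curve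
`Wd ≅ W ⊗ χ_{−∏S}` good at every prime of `S`; `not_twoStepAt_into_of_check` closes when a `decide +kernel` enumeration of the sublists refutes these
conditions, `not_twoStepAt_into_of_check_except` when it pins `∏S = m₀` and a supplied lemma shows some prime `q₀ ∣ m₀` divides `N_{Wd}` for every
`Wd ≅ W ⊗ χ_{−m₀}`. §k per cell and vertex: `reverseData_<tag>` (`2 ∣ N`, the odd bad primes divide `N` — `…DoorPrice.dvd_conductorNorm_of_dvd_Δ` —,
every prime of `N` is `2` or in the list — `…DoorPriceSharp.dvd_Δ_of_dvd_conductorNorm` + the certified factorisation of `Δ` —, the multiplicative odd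
primes have exponent one — `hasMultiplicativeReductionAtPrime_of_intModel`), `check_<tag>` (`decide +kernel`), `not_twoStepAt_into_<tag>` (vertex,
unconditional) and `not_twoStepAt_into_isogenous_<tag>` (class, `N_{W₁} = N_E` by `ModularForms.conductorNorm_eq_of_isIsogenous_of_modularity`).
CELL HERE: g19 = −19/13 ⊗ χ₋₄₂ (w6 g19, p745174), `N = 2⁶·3²·7²·13·19·269²`; parts II–IV: the other twelve.
HONEST FRAMING: elementary kernel facts about explicit equations, conductors of quadratic twists, fundamental discriminants and quadratic residues; the class-level
statements are CONDITIONAL on `nonempty_modularParametrizationData` (modularity, a conjunct of the doors' own cone) for the transport `N_{W₁} = N_E` (and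
`N_{W₁ ⊗ χ} = N_{E ⊗ χ}`) only; nothing about any L-value, Selmer group, main conjecture or BSD is asserted; the doors of twistback 6⁷ stay CONDITIONAL and
un-instantiated; closes no registered stub; 0 cells / labels / stubs / tiers move; no summit statement, no case of Mazur's main conjecture and no case of BSD
is proved for any curve. Memo of record: `P13-NO-REVERSE-EDGE-w6g22.md` (evidence on -19033); mirror `HOME/line-x2-p1-w6-g22/`.
References: [GrossLMS1991] §1; [AtkinLehner1970] Thm. 4; [SilvermanATAEC1994] IV.9.4, IV.10; [SilvermanAEC2009] VII.5 Prop. 5.1, X.2 Prop. 2.4, X.5 Cor. 5.4, App. C §16;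
[CremonaAlgorithms1997] §3.9; [IrelandRosen1990] Prop. 13.1.3–13.1.4; [Cohen1993] Def. 5.1.2; this lane's `…KernelCertP13DoorPrice` (p764408), `…DoorPriceSharp` (p766176),
`…DoorPriceClassI` (p766256) / `…ClassII` (p766650), x2-p1-w6 g3 `…TwistbackTwoStepDefs`.
-/

set_option autoImplicit false
-- `Summit.BirchSwinnertonDyer.BirchSwinnertonDyer.…`: the summit and its single sub-problem share a name.
set_option linter.dupNamespace false

noncomputable section

open scoped Classical
open WeierstrassCurve NumberField Literature.NumberTheory.EllipticCurves
  Literature.NumberTheory.EllipticCurves.ModularForms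
  Literature.NumberTheory.QuadraticFields
  IsDedekindDomain Rat.HeightOneSpectrum
  Summit.BirchSwinnertonDyer.BirchSwinnertonDyer.Rank1Residual.X11RankOne
  Summit.BirchSwinnertonDyer.BirchSwinnertonDyer.Rank1Residual.IntModel
  Summit.BirchSwinnertonDyer.Rank1Residual
  Summit.BirchSwinnertonDyer.BirchSwinnertonDyer.Theorems
  Summit.BirchSwinnertonDyer.BirchSwinnertonDyer.Theorems.EisensteinPrimesMazurMCOnCellBTwistbackTwoStepDefs
  Summit.BirchSwinnertonDyer.BirchSwinnertonDyer.Theorems.EisensteinPrimesMazurMCOnCellBKernelCertP13DoorPrice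
  Summit.BirchSwinnertonDyer.BirchSwinnertonDyer.Theorems.EisensteinPrimesMazurMCOnCellBKernelCertP13DoorPriceSharp
  Summit.BirchSwinnertonDyer.BirchSwinnertonDyer.Theorems.EisensteinPrimesMazurMCOnCellBKernelCertP13DoorPriceClassI

namespace Summit.BirchSwinnertonDyer.BirchSwinnertonDyer.Theorems.EisensteinPrimesMazurMCOnCellBKernelCertP13NoReverseEdge

/-! ## §0 Generic: the support constraint on the second field of a reverse edge; the enumeration engines -/

/-- **THE SUPPORT CONSTRAINT.** If `C • W = Wd ⊗ χ_{d_K}` with `Wd` globally minimal, `K` imaginary quadratic with `d_K` odd and Heegner for `N_{Wd}`, then every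
prime `q ∣ d_K` has `q² ∣ N_W`: `q ∤ N_{Wd}` (`SatisfiesHeegnerHypothesis.not_dvd_discr`), so `Wd` is good at `q` (`hasGoodReductionAt_of_not_dvd_conductorNorm`); `q ∥ d_K` (`Quadratic.not_sq_dvd_discr_of_prime_ne_two`);
the twist of a good curve by a character ramified at the odd prime `q` is additive at `q` (`hasAdditiveReductionAt_quadraticTwist_of_dvd`), so `f_q(Wd ⊗ χ_{d_K}) ≥ 2`
(`two_le_conductorExponent_iff`), and `f_q` is an isomorphism invariant (`conductorExponent_smul'`). [cite: SilvermanAEC2009, VII.5 Prop. 5.1(c) and App. C §16] [cite: GrossLMS1991, §1 (p. 235)] -/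
theorem sq_dvd_conductorNorm_of_dvd_discr {W Wd : WeierstrassCurve ℚ} [W.IsElliptic] [Wd.IsElliptic] [Wd.IsGloballyMinimal]
    {K : Type} [Field K] [NumberField K] (hK : IsImaginaryQuadratic K)
    (hHN : SatisfiesHeegnerHypothesis (Wd.conductorNorm ℤ) K) (hodd : Odd (NumberField.discr K))
    {C : VariableChange ℚ} (hC : C • W = Wd.quadraticTwist (NumberField.discr K : ℚ))
    {q : ℕ} (hq : q.Prime) (hqd : (q : ℤ) ∣ NumberField.discr K) : q ^ 2 ∣ W.conductorNorm ℤ := by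
  have hd0 : NumberField.discr K ≠ 0 := by
    intro h; rw [h, Int.odd_iff] at hodd; omega
  have hdq : (NumberField.discr K : ℚ) ≠ 0 := by exact_mod_cast hd0
  haveI := Wd.isElliptic_quadraticTwist hdq
  have hq2 : q ≠ 2 := by
    rintro rfl; rw [Int.odd_iff] at hodd; omega
  have hqN : ¬ q ∣ Wd.conductorNorm ℤ := fun h =>
    Literature.SatisfiesHeegnerHypothesis.not_dvd_discr hK.1 hHN hq h hqd
  set p : Nat.Primes := ⟨q, hq⟩ with hp
  set w : HeightOneSpectrum (𝓞 ℚ) := (primesEquiv (R := 𝓞 ℚ)).symm p with hw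
  have hwp : primesEquiv w = p := Equiv.apply_symm_apply _ p
  set v : HeightOneSpectrum ℤ := (primesEquiv (R := ℤ)).symm p with hv
  have hgen : natGenerator v = q :=
    congrArg (fun q : Nat.Primes ↦ (q : ℕ)) ((primesEquiv (R := ℤ)).apply_symm_apply p)
  have hgood : Wd.HasGoodReductionAt w :=
    Literature.NumberTheory.EllipticCurves.hasGoodReductionAt_of_not_dvd_conductorNorm Wd w (by rw [hwp]; exact hqN)
  have hsq : ¬ ((q : ℤ) ^ 2 ∣ NumberField.discr K) := Quadratic.not_sq_dvd_discr_of_prime_ne_two hK.1 hq hq2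
  have hadd : (Wd.quadraticTwist (NumberField.discr K : ℚ)).HasAdditiveReductionAt w :=
    Wd.hasAdditiveReductionAt_quadraticTwist_of_dvd w (by rw [hwp]; exact hq2) hd0
      (by rw [hwp]; exact hqd) (by rw [hwp]; exact hsq) hgood
  have haddv : (Wd.quadraticTwist (NumberField.discr K : ℚ)).HasAdditiveReductionAt v :=
    ((Wd.quadraticTwist (NumberField.discr K : ℚ)).hasAdditiveReductionAt_int_iff_ringOfIntegers p).mpr hadd
  have h2le : 2 ≤ (Wd.quadraticTwist (NumberField.discr K : ℚ)).conductorExponent v :=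
    (two_le_conductorExponent_iff_holds v _).mpr haddv
  have hsm : (C • W).conductorExponent v = W.conductorExponent v := conductorExponent_smul' v W C
  rw [hC] at hsm
  have hfW := factorization_conductorNorm_holds W v
  rw [hgen] at hfW
  have hle : 2 ≤ (W.conductorNorm ℤ).factorization q := by rw [hfW, ← hsm]; exact h2le
  exact (hq.pow_dvd_iff_le_factorization (conductorNorm_pos_holds W).ne').mpr hle

/-- **Support bookkeeping.** A squarefree `n` all of whose prime factors lie in a nodup list `ps` of primes is the product of the sublist of `ps` dividing it
(`Nat.prod_primeFactors_of_squarefree`, `Finset.prod_primes_dvd`). [folklore] -/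
theorem prod_filter_dvd_eq (ps : List ℕ) (hnd : ps.Nodup) (hpr : ∀ q ∈ ps, q.Prime) (n : ℕ) (hn : Squarefree n)
    (hmem : ∀ ℓ : ℕ, ℓ.Prime → ℓ ∣ n → ℓ ∈ ps) : (ps.filter (· ∣ n)).prod = n := by
  set S := ps.filter (· ∣ n) with hS
  have hSnd : S.Nodup := hnd.filter _
  have hSF : S.toFinset.prod id = S.prod := by rw [List.prod_toFinset _ hSnd, List.map_id]
  apply Nat.dvd_antisymm
  · rw [← hSF]
    refine Finset.prod_primes_dvd n (fun a ha => ?_) (fun a ha => ?_)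
    · have := List.mem_toFinset.mp ha
      rw [hS, List.mem_filter] at this
      exact Nat.prime_iff.mp (hpr a this.1)
    · have := List.mem_toFinset.mp ha
      rw [hS, List.mem_filter] at this
      simpa using this.2
  · rw [← Nat.prod_primeFactors_of_squarefree hn, ← hSF]
    refine Finset.prod_dvd_prod_of_subset _ _ (fun a : ℕ => a) (fun ℓ hℓ => ?_)
    have hℓp : ℓ.Prime := Nat.prime_of_mem_primeFactors hℓ
    have hℓn : ℓ ∣ n := Nat.dvd_of_mem_primeFactors hℓ
    rw [List.mem_toFinset, hS, List.mem_filter]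
    exact ⟨hmem ℓ hℓp hℓn, by simpa using hℓn⟩

/-- **Twisting back.** `C • W = Wd ⊗ χ_d` (`d ≠ 0`) gives `C′ • Wd = W ⊗ χ_d`: twist both sides by `d` (`quadraticTwist_smul`, `quadraticTwist_quadraticTwist`) and
use `Wd ≅ Wd ⊗ χ_1 ≅ Wd ⊗ χ_{d²}` (`exists_variableChange_quadraticTwist_one`, `…_mul_sq`). [cite: SilvermanAEC2009, X.2 Prop. 2.4 and X.5 Cor. 5.4] -/
theorem exists_variableChange_twist_back {W Wd : WeierstrassCurve ℚ} {d : ℚ} (hd : d ≠ 0) {C : VariableChange ℚ}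
    (hC : C • W = Wd.quadraticTwist d) : ∃ C' : VariableChange ℚ, C' • Wd = W.quadraticTwist d := by
  obtain ⟨C₁, hC₁⟩ := Wd.exists_variableChange_quadraticTwist_one
  obtain ⟨C₂, hC₂⟩ := Wd.exists_variableChange_quadraticTwist_mul_sq 1 d hd
  have h3 : (C • W).quadraticTwist d = Wd.quadraticTwist (d * d) := by rw [hC, quadraticTwist_quadraticTwist]
  rw [quadraticTwist_smul] at h3
  refine ⟨(⟨C.u, d * C.r, 0, 0⟩ : VariableChange ℚ)⁻¹ * (C₂ * C₁), ?_⟩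
  rw [mul_smul, mul_smul, hC₁, hC₂, show (1 : ℚ) * d ^ 2 = d * d by ring, ← h3, inv_smul_smul]

/-- **Reverse-edge engine (data form).** For an elliptic `W` with `2 ∣ N_W`, `ps` a nodup list of odd primes dividing `N_W` such that every prime of `N_W` is `2` or in
`ps`, and `psm ⊆` primes with `q² ∤ N_W`: a reverse edge `TwoStepAt 13 U W` yields a sublist `S` of `ps` with `∏S > 4`, `−∏S ≡ 1 (mod 8)`, `(−∏S)⁶ = 1` in `𝔽₁₃`,
`q ∣ ∏S ∨ (−∏S)^((q−1)/2) = 1` in `𝔽_q` for `q ∈ ps`, no `q ∈ psm` in `S` — namely `d_{K″} = −∏S` for the edge's second field `K″` (the residue conditions are g21's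
`…DoorPriceClassI.discr_le_of_twoStepAt_into_of_check`; the support is `sq_dvd_conductorNorm_of_dvd_discr` + `Quadratic.isFundamentalDiscriminant_discr` +
`prod_filter_dvd_eq`) — together with a curve `Wd ≅ W ⊗ χ_{−∏S}` (`exists_variableChange_twist_back`) GOOD at every prime of `S` (`q ∤ N_{Wd}`).
[cite: GrossLMS1991, §1 (p. 235)] [cite: IrelandRosen1990, Prop. 13.1.3 and Prop. 5.1.1] -/
theorem exists_sublist_of_twoStepAt_into {W : WeierstrassCurve ℚ} [W.IsElliptic] (ps psm : List ℕ) (hnd : ps.Nodup)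
    (h2 : 2 ∣ W.conductorNorm ℤ) (hps : ∀ q ∈ ps, q.Prime ∧ q ≠ 2 ∧ q ∣ W.conductorNorm ℤ)
    (hcover : ∀ ℓ : ℕ, ℓ.Prime → ℓ ∣ W.conductorNorm ℤ → ℓ = 2 ∨ ℓ ∈ ps)
    (hpsm : ∀ q ∈ psm, q.Prime ∧ ¬ q ^ 2 ∣ W.conductorNorm ℤ)
    (U : WeierstrassCurve ℚ) (h : TwoStepAt 13 U W) :
    ∃ S ∈ ps.sublists, 4 < S.prod ∧ (-(S.prod : ℤ)) % 8 = 1 ∧ ((-(S.prod : ℤ) : ℤ) : ZMod 13) ^ 6 = 1 ∧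
      (∀ q ∈ ps, (q : ℤ) ∣ -(S.prod : ℤ) ∨ ((-(S.prod : ℤ) : ℤ) : ZMod q) ^ (q / 2) = 1) ∧ (∀ q ∈ psm, ¬ q ∣ S.prod) ∧
      ∃ (Wd : WeierstrassCurve ℚ) (_ : Wd.IsElliptic), (∃ C' : VariableChange ℚ, C' • Wd = W.quadraticTwist (-(S.prod : ℚ))) ∧
        ∀ q : ℕ, q.Prime → q ∣ S.prod → ¬ q ∣ Wd.conductorNorm ℤ := by
  obtain ⟨_, _, _, _, K₁, _, _, hK₁, -, -, -, -, -, Wd, hWdE, hWdM, -, K, iF, iN, hK, hodd, hlt, hHN, hHp, -,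
    ⟨C, hC⟩⟩ := h
  have hd4 : NumberField.discr K % 4 = 1 := by
    rcases Quadratic.discr_emod_four hK.1 with h0 | h1
    · exfalso; rw [Int.odd_iff] at hodd; omega
    · exact h1
  have h8 : NumberField.discr K % 8 = 1 := by
    have h2d : ¬ (2 : ℤ) ∣ NumberField.discr K := by rw [Int.odd_iff] at hodd; omega
    exact discr_emod_eight_of_heegner hK hHN
      (EisensteinPrimesMazurMCOnCellBKernelCertP13DoorPriceClassI.dvd_conductorNorm_of_smul_eq_quadraticTwist hd4 hC
        Nat.prime_two h2 (by exact_mod_cast h2d))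
  haveI : Fact (Nat.Prime 13) := ⟨by norm_num⟩
  have h13 : ((NumberField.discr K : ℤ) : ZMod 13) ^ (13 / 2) = 1 :=
    discr_pow_eq_one_of_heegner hK hHp 13 (by decide) (dvd_refl 13)
  have hres : ∀ q ∈ ps, (q : ℤ) ∣ NumberField.discr K ∨ ((NumberField.discr K : ℤ) : ZMod q) ^ (q / 2) = 1 := by
    intro q hq
    obtain ⟨hqp, hq2, hqN⟩ := hps q hq
    by_cases hqd : (q : ℤ) ∣ NumberField.discr K
    · exact Or.inl hqd
    · haveI : Fact q.Prime := ⟨hqp⟩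
      exact Or.inr (discr_pow_eq_one_of_heegner hK hHN q hq2
        (EisensteinPrimesMazurMCOnCellBKernelCertP13DoorPriceClassI.dvd_conductorNorm_of_smul_eq_quadraticTwist hd4 hC hqp hqN hqd))
  -- support: every prime of `d_K` is in `ps`
  have hmem : ∀ ℓ : ℕ, ℓ.Prime → ℓ ∣ (NumberField.discr K).natAbs → ℓ ∈ ps := by
    intro ℓ hℓ hℓd
    have hℓd' : (ℓ : ℤ) ∣ NumberField.discr K := Int.natCast_dvd.mpr hℓd
    have hsq := sq_dvd_conductorNorm_of_dvd_discr hK hHN hodd hC hℓ hℓd'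
    have hℓN : ℓ ∣ W.conductorNorm ℤ := (dvd_pow_self ℓ two_ne_zero).trans hsq
    rcases hcover ℓ hℓ hℓN with rfl | hm
    · exfalso; rw [Int.odd_iff] at hodd; omega
    · exact hm
  have hsqf : Squarefree (NumberField.discr K).natAbs := by
    rcases Quadratic.isFundamentalDiscriminant_discr hK.1 with ⟨-, hsf, -⟩ | ⟨h4, -, -⟩
    · exact Int.squarefree_natAbs.mpr hsf
    · exfalso; rw [Int.odd_iff] at hodd; omega
  set S := ps.filter (· ∣ (NumberField.discr K).natAbs) with hS
  have hSprod : S.prod = (NumberField.discr K).natAbs :=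
    prod_filter_dvd_eq ps hnd (fun q hq => (hps q hq).1) _ hsqf hmem
  have hdS : NumberField.discr K = -(S.prod : ℤ) := by rw [hSprod]; omega
  have hd0 : (NumberField.discr K : ℚ) ≠ 0 := by exact_mod_cast (show NumberField.discr K ≠ 0 by omega)
  obtain ⟨C', hC'⟩ := exists_variableChange_twist_back hd0 hC
  refine ⟨S, List.mem_sublists.mpr (List.filter_sublist), by rw [hSprod]; omega, by rw [← hdS]; exact h8, by rw [← hdS]; exact h13,
    by rw [← hdS]; exact hres, ?_, Wd, hWdE, ⟨C', by rw [hC', hdS, Int.cast_neg, Int.cast_natCast]⟩, ?_⟩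
  · intro q hq hqS
    obtain ⟨hqp, hqsq⟩ := hpsm q hq
    have hqd : (q : ℤ) ∣ NumberField.discr K := by
      rw [hdS]; exact dvd_neg.mpr (Int.natCast_dvd_natCast.mpr hqS)
    exact hqsq (sq_dvd_conductorNorm_of_dvd_discr hK hHN hodd hC hqp hqd)
  · intro q hq hqS hqN
    have hqd : (q : ℤ) ∣ NumberField.discr K := by
      rw [hdS]; exact dvd_neg.mpr (Int.natCast_dvd_natCast.mpr hqS)
    exact Literature.SatisfiesHeegnerHypothesis.not_dvd_discr hK.1 hHN hq hqN hqd

/-- **Engine, empty case.** If the `decide`-able enumeration over the sublists of `ps` refutes the conditions of `exists_sublist_of_twoStepAt_into`, there is NO reverse edge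
into `W`. [cite: GrossLMS1991, §1 (p. 235)] -/
theorem not_twoStepAt_into_of_check {W : WeierstrassCurve ℚ} [W.IsElliptic] (ps psm : List ℕ) (hnd : ps.Nodup)
    (h2 : 2 ∣ W.conductorNorm ℤ) (hps : ∀ q ∈ ps, q.Prime ∧ q ≠ 2 ∧ q ∣ W.conductorNorm ℤ)
    (hcover : ∀ ℓ : ℕ, ℓ.Prime → ℓ ∣ W.conductorNorm ℤ → ℓ = 2 ∨ ℓ ∈ ps)
    (hpsm : ∀ q ∈ psm, q.Prime ∧ ¬ q ^ 2 ∣ W.conductorNorm ℤ)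
    (hcheck : ∀ S ∈ ps.sublists, 4 < S.prod → (-(S.prod : ℤ)) % 8 = 1 → ((-(S.prod : ℤ) : ℤ) : ZMod 13) ^ 6 = 1 →
      (∀ q ∈ ps, (q : ℤ) ∣ -(S.prod : ℤ) ∨ ((-(S.prod : ℤ) : ℤ) : ZMod q) ^ (q / 2) = 1) → (∀ q ∈ psm, ¬ q ∣ S.prod) → False)
    (U : WeierstrassCurve ℚ) : ¬ TwoStepAt 13 U W := fun h => by
  obtain ⟨S, hS, h4, h8, h13, hres, hm, -⟩ := exists_sublist_of_twoStepAt_into ps psm hnd h2 hps hcover hpsm U h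
  exact hcheck S hS h4 h8 h13 hres hm

/-- **Engine, one-survivor case.** If the enumeration pins `∏S = m₀`, and for some prime `q₀ ∣ m₀` every curve `Wd ≅ W ⊗ χ_{−m₀}` has `q₀ ∣ N_{Wd}` (the twist does NOT
remove `q₀` from the conductor), there is NO reverse edge into `W` (`Wd` would be good at `q₀`). [cite: GrossLMS1991, §1 (p. 235)] -/
theorem not_twoStepAt_into_of_check_except {W : WeierstrassCurve ℚ} [W.IsElliptic] (ps psm : List ℕ) (hnd : ps.Nodup)
    (h2 : 2 ∣ W.conductorNorm ℤ) (hps : ∀ q ∈ ps, q.Prime ∧ q ≠ 2 ∧ q ∣ W.conductorNorm ℤ)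
    (hcover : ∀ ℓ : ℕ, ℓ.Prime → ℓ ∣ W.conductorNorm ℤ → ℓ = 2 ∨ ℓ ∈ ps)
    (hpsm : ∀ q ∈ psm, q.Prime ∧ ¬ q ^ 2 ∣ W.conductorNorm ℤ) (m₀ q₀ : ℕ) (hq₀ : q₀.Prime) (hq₀m : q₀ ∣ m₀)
    (hcheck : ∀ S ∈ ps.sublists, 4 < S.prod → (-(S.prod : ℤ)) % 8 = 1 → ((-(S.prod : ℤ) : ℤ) : ZMod 13) ^ 6 = 1 →
      (∀ q ∈ ps, (q : ℤ) ∣ -(S.prod : ℤ) ∨ ((-(S.prod : ℤ) : ℤ) : ZMod q) ^ (q / 2) = 1) → (∀ q ∈ psm, ¬ q ∣ S.prod) → S.prod = m₀)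
    (hexc : ∀ (Wd : WeierstrassCurve ℚ) [Wd.IsElliptic], (∃ C' : VariableChange ℚ, C' • Wd = W.quadraticTwist (-(m₀ : ℚ))) → q₀ ∣ Wd.conductorNorm ℤ)
    (U : WeierstrassCurve ℚ) : ¬ TwoStepAt 13 U W := fun h => by
  obtain ⟨S, hS, h4, h8, h13, hres, hm, Wd, hWdE, hWd, hgood⟩ := exists_sublist_of_twoStepAt_into ps psm hnd h2 hps hcover hpsm U h
  have hm₀ : S.prod = m₀ := hcheck S hS h4 h8 h13 hres hm
  rw [hm₀] at hWd hgood
  exact hgood q₀ hq₀ hq₀m (hexc Wd hWd)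

/-- **Per-curve data from an integer certificate.** For a globally minimal `W = W₀ ⊗ ℚ` with `Δ(W₀) = ±∏ q^e` over a list `l` of primes: `2 ∣ N_W` and every listed odd
prime divides `N_W` (`…DoorPrice.dvd_conductorNorm_of_dvd_Δ`); every prime of `N_W` is `2` or in `ps ⊇` the odd primes of `l` (`…DoorPriceSharp.dvd_Δ_of_dvd_conductorNorm`,
`mem_of_prime_dvd_prod_pow`); the primes of `psm` (`q ∣ Δ`, `q ∤ c₄`: multiplicative, `hasMultiplicativeReductionAtPrime_of_intModel`) have exponent one
(`GenusGrossZagier.not_sq_dvd_conductorNorm_of_mult`).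
[cite: SilvermanAEC2009, VII.5 Prop. 5.1] [cite: BombieriGubler2006, 12.5.9(d)] -/
theorem reverseData_of_cert {W₀ : WeierstrassCurve ℤ} {W : WeierstrassCurve ℚ} [W.IsElliptic] [W.IsGloballyMinimal]
    (hW : W₀.baseChange ℚ = W) (hI : integralModelInt W = W₀) (l : List (ℕ × ℕ)) (hl : ∀ qe ∈ l, qe.1.Prime)
    (hΔ : W₀.Δ = -(((l.map fun qe => qe.1 ^ qe.2).prod : ℕ) : ℤ) ∨ W₀.Δ = (((l.map fun qe => qe.1 ^ qe.2).prod : ℕ) : ℤ))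
    (h2 : (2 : ℤ) ∣ W₀.Δ) (ps : List ℕ) (hps : ∀ q ∈ ps, q.Prime ∧ q ≠ 2 ∧ (q : ℤ) ∣ W₀.Δ)
    (hcov : ∀ qe ∈ l, qe.1 = 2 ∨ qe.1 ∈ ps)
    (psm : List ℕ) (hpsm : ∀ q ∈ psm, q.Prime ∧ (q : ℤ) ∣ W₀.Δ ∧ ¬ (q : ℤ) ∣ W₀.c₄) :
    2 ∣ W.conductorNorm ℤ ∧ (∀ q ∈ ps, q.Prime ∧ q ≠ 2 ∧ q ∣ W.conductorNorm ℤ) ∧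
      (∀ ℓ : ℕ, ℓ.Prime → ℓ ∣ W.conductorNorm ℤ → ℓ = 2 ∨ ℓ ∈ ps) ∧ (∀ q ∈ psm, q.Prime ∧ ¬ q ^ 2 ∣ W.conductorNorm ℤ) := by
  refine ⟨dvd_conductorNorm_of_dvd_Δ _ hW Nat.prime_two h2, fun q hq => ?_, fun ℓ hℓ hℓN => ?_, fun q hq => ?_⟩
  · obtain ⟨hqp, hq2, hqΔ⟩ := hps q hq
    exact ⟨hqp, hq2, dvd_conductorNorm_of_dvd_Δ _ hW hqp hqΔ⟩
  · have hΔ' := dvd_Δ_of_dvd_conductorNorm _ hW hℓ hℓN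
    have hP : ℓ ∣ ((l.map fun qe => qe.1 ^ qe.2).prod) := by
      rcases hΔ with h | h <;> rw [h] at hΔ'
      · exact_mod_cast (dvd_neg.mp hΔ')
      · exact_mod_cast hΔ'
    obtain ⟨qe, hqe, hq1⟩ := List.mem_map.mp (mem_of_prime_dvd_prod_pow hℓ l hl hP)
    rw [← hq1]
    exact hcov qe hqe
  · obtain ⟨hqp, hqΔ, hqc⟩ := hpsm q hq
    haveI : Fact q.Prime := ⟨hqp⟩
    exact ⟨hqp, GenusGrossZagier.not_sq_dvd_conductorNorm_of_mult W q
      (hasMultiplicativeReductionAtPrime_of_intModel hI q hqΔ hqc)⟩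

/-- **What «no reverse edge» buys for the left door.** The zig-zag relation of 6⁷'s left door `…_of_connectedClassShaUnit` steps `A → B` by a forward edge `TwoStepAt 13 A B` or a
reverse one `TwoStepAt 13 B A` (into a Cell-B vertex). If NO reverse edge ends at `W₁`, a zig-zag out of `W₁` is trivial or STARTS WITH A FORWARD EDGE (`Relation.ReflTransGen.cases_head`)
— priced by `…DoorPrice*.discr_le_of_heegner_isogenous_*`. [folklore] -/
theorem eq_or_firstStep_forward_of_not_into [Fact (Nat.Prime 13)] {W₁ U : WeierstrassCurve ℚ} (hno : ∀ B : WeierstrassCurve ℚ, ¬ TwoStepAt 13 B W₁)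
    (h : Relation.ReflTransGen (fun A B : WeierstrassCurve ℚ ↦ TwoStepAt 13 A B ∨
      (TwoStepAt 13 B A ∧ ∃ (_ : B.IsElliptic) (_ : B.IsGloballyMinimal), X2.CellB B 13)) W₁ U) :
    U = W₁ ∨ ∃ B : WeierstrassCurve ℚ, TwoStepAt 13 W₁ B ∧ Relation.ReflTransGen (fun A B : WeierstrassCurve ℚ ↦ TwoStepAt 13 A B ∨
      (TwoStepAt 13 B A ∧ ∃ (_ : B.IsElliptic) (_ : B.IsGloballyMinimal), X2.CellB B 13)) B U := by
  rcases h.cases_head with h0 | ⟨B, hWB, hBU⟩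
  · exact Or.inl h0.symm
  · rcases hWB with hf | ⟨hr, -⟩
    · exact Or.inr ⟨B, hf, hBU⟩
    · exact absurd hr (hno B)

/-! ## Cell g19 — −19/13 ⊗ χ₋₄₂ (w6 g19, p745174), `N = 504452265408 = 2⁶·3²·7²·13·19·269²`: additive odd primes `[3, 7, 269]`, multiplicative odd primes `[13, 19]`; candidate second fields of a reverse edge: NONE -/

/-- Engine data of `E` of cell g19 (`reverseData_of_cert`; `Δ = −2⁶·3⁶·7¹⁰·13¹³·19·269³`; odd bad primes `[3, 7, 13, 19, 269]`; multiplicative `[13, 19]`: `q ∣ Δ`, `q ∤ c₄`). [cite: SilvermanAEC2009, VII.5 Prop. 5.1] -/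
theorem reverseData_e13a10 :
    2 ∣ (⟨0, 0, 0, 55547317476, 58239761976082638⟩ : WeierstrassCurve ℚ).conductorNorm ℤ ∧
    (∀ q ∈ ([3, 7, 13, 19, 269] : List ℕ), q.Prime ∧ q ≠ 2 ∧ q ∣ (⟨0, 0, 0, 55547317476, 58239761976082638⟩ : WeierstrassCurve ℚ).conductorNorm ℤ) ∧
    (∀ ℓ : ℕ, ℓ.Prime → ℓ ∣ (⟨0, 0, 0, 55547317476, 58239761976082638⟩ : WeierstrassCurve ℚ).conductorNorm ℤ → ℓ = 2 ∨ ℓ ∈ ([3, 7, 13, 19, 269] : List ℕ)) ∧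
    (∀ q ∈ ([13, 19] : List ℕ), q.Prime ∧ ¬ q ^ 2 ∣ (⟨0, 0, 0, 55547317476, 58239761976082638⟩ : WeierstrassCurve ℚ).conductorNorm ℤ) := by
  haveI := EisensteinPrimesMazurMCOnCellBKernelCertP13NoUnitVertex.isElliptic_e13a10; haveI := EisensteinPrimesMazurMCOnCellBKernelCertP13NoUnitVertex.isGloballyMinimal_e13a10
  have hb := baseChange_mk_int 0 0 0 55547317476 58239761976082638
  push_cast at hb
  exact reverseData_of_cert hb (integralModelInt_eq_of_map_eq _ (map_mk_int 0 0 0 55547317476 58239761976082638)) [(2, 6), (3, 6), (7, 10), (13, 13), (19, 1), (269, 3)]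
    (by intro qe h; fin_cases h <;> norm_num) (Or.inl (by rw [intCurve_Δ]; decide +kernel)) (by rw [intCurve_Δ]; decide +kernel) _
    (by intro q hq; fin_cases hq <;> exact ⟨by norm_num, by decide, by rw [intCurve_Δ]; decide +kernel⟩) (by decide) _
    (by intro q hq; fin_cases hq <;> exact ⟨by norm_num, by rw [intCurve_Δ]; decide +kernel, by rw [intCurve_c₄]; decide +kernel⟩)

/-- Enumeration at `E` of cell g19: NO sublist `S` of `[3, 7, 13, 19, 269]` passes the five conditions — the candidate set of second fields of a reverse edge is EMPTY. [folklore] -/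
theorem check_e13a10 : ∀ S ∈ ([3, 7, 13, 19, 269] : List ℕ).sublists, 4 < S.prod → (-(S.prod : ℤ)) % 8 = 1 → ((-(S.prod : ℤ) : ℤ) : ZMod 13) ^ 6 = 1 →
    (∀ q ∈ ([3, 7, 13, 19, 269] : List ℕ), (q : ℤ) ∣ -(S.prod : ℤ) ∨ ((-(S.prod : ℤ) : ℤ) : ZMod q) ^ (q / 2) = 1) →
    (∀ q ∈ ([13, 19] : List ℕ), ¬ q ∣ S.prod) → False := by
  decide +kernel

/-- **NO reverse edge into `E` of cell g19** (−19/13 ⊗ χ₋₄₂ (w6 g19, p745174); `N = 504452265408`; additive odd primes `[3, 7, 269]`, multiplicative `[13, 19]`): for every `U`, `¬ TwoStepAt 13 U E` — UNCONDITIONAL.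
[cite: GrossLMS1991, §1 (p. 235)] -/
theorem not_twoStepAt_into_e13a10 (U : WeierstrassCurve ℚ) : ¬ TwoStepAt 13 U (⟨0, 0, 0, 55547317476, 58239761976082638⟩ : WeierstrassCurve ℚ) := by
  haveI := EisensteinPrimesMazurMCOnCellBKernelCertP13NoUnitVertex.isElliptic_e13a10
  obtain ⟨h2, hps, hcover, hpsm⟩ := reverseData_e13a10
  exact not_twoStepAt_into_of_check _ _ (by decide) h2 hps hcover hpsm check_e13a10 U

/-- **NO reverse edge into ANY curve `W₁` isogenous to `E` of cell g19** (granted modularity: `N_{W₁} = N_E`, Atkin–Lehner, `ModularForms.conductorNorm_eq_of_isIsogenous_of_modularity`):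
for every `U`, `¬ TwoStepAt 13 U W₁` — every zig-zag of 6⁷'s left door out of this class starts with a FORWARD edge (`…DoorPriceClass*.discr_le_of_heegner_isogenous_e13a10`).
[cite: AtkinLehner1970, Thm. 4] [cite: GrossLMS1991, §1 (p. 235)] -/
theorem not_twoStepAt_into_isogenous_e13a10 (hmod : nonempty_modularParametrizationData) (W₁ : WeierstrassCurve ℚ) [W₁.IsElliptic]
    (hiso : IsIsogenous (⟨0, 0, 0, 55547317476, 58239761976082638⟩ : WeierstrassCurve ℚ) W₁) (U : WeierstrassCurve ℚ) : ¬ TwoStepAt 13 U W₁ := by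
  haveI := EisensteinPrimesMazurMCOnCellBKernelCertP13NoUnitVertex.isElliptic_e13a10
  have hN : W₁.conductorNorm ℤ = (⟨0, 0, 0, 55547317476, 58239761976082638⟩ : WeierstrassCurve ℚ).conductorNorm ℤ := (conductorNorm_eq_of_isIsogenous_of_modularity hmod _ W₁ hiso).symm
  obtain ⟨h2, hps, hcover, hpsm⟩ := reverseData_e13a10
  exact not_twoStepAt_into_of_check _ _ (by decide) (by rw [hN]; exact h2) (by rw [hN]; exact hps) (by rw [hN]; exact hcover)
    (by rw [hN]; exact hpsm) check_e13a10 U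

/-- Engine data of `E′` of cell g19 (`reverseData_of_cert`; `Δ = −2⁶·3⁶·7¹⁰·13·19¹³·269³`; odd bad primes `[3, 7, 13, 19, 269]`; multiplicative `[13, 19]`: `q ∣ Δ`, `q ∤ c₄`). [cite: SilvermanAEC2009, VII.5 Prop. 5.1] -/
theorem reverseData_e13b10 :
    2 ∣ (⟨0, 0, 0, -520366084299684, -4568899355131477948722⟩ : WeierstrassCurve ℚ).conductorNorm ℤ ∧
    (∀ q ∈ ([3, 7, 13, 19, 269] : List ℕ), q.Prime ∧ q ≠ 2 ∧ q ∣ (⟨0, 0, 0, -520366084299684, -4568899355131477948722⟩ : WeierstrassCurve ℚ).conductorNorm ℤ) ∧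
    (∀ ℓ : ℕ, ℓ.Prime → ℓ ∣ (⟨0, 0, 0, -520366084299684, -4568899355131477948722⟩ : WeierstrassCurve ℚ).conductorNorm ℤ → ℓ = 2 ∨ ℓ ∈ ([3, 7, 13, 19, 269] : List ℕ)) ∧
    (∀ q ∈ ([13, 19] : List ℕ), q.Prime ∧ ¬ q ^ 2 ∣ (⟨0, 0, 0, -520366084299684, -4568899355131477948722⟩ : WeierstrassCurve ℚ).conductorNorm ℤ) := by
  haveI := EisensteinPrimesMazurMCOnCellBKernelCertP13NoUnitVertex.isElliptic_e13b10; haveI := EisensteinPrimesMazurMCOnCellBKernelCertP13NoUnitVertex.isGloballyMinimal_e13b10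
  have hb := baseChange_mk_int 0 0 0 (-520366084299684) (-4568899355131477948722)
  push_cast at hb
  exact reverseData_of_cert hb (integralModelInt_eq_of_map_eq _ (map_mk_int 0 0 0 (-520366084299684) (-4568899355131477948722))) [(2, 6), (3, 6), (7, 10), (13, 1), (19, 13), (269, 3)]
    (by intro qe h; fin_cases h <;> norm_num) (Or.inl (by rw [intCurve_Δ]; decide +kernel)) (by rw [intCurve_Δ]; decide +kernel) _
    (by intro q hq; fin_cases hq <;> exact ⟨by norm_num, by decide, by rw [intCurve_Δ]; decide +kernel⟩) (by decide) _
    (by intro q hq; fin_cases hq <;> exact ⟨by norm_num, by rw [intCurve_Δ]; decide +kernel, by rw [intCurve_c₄]; decide +kernel⟩)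

/-- **NO reverse edge into `E′` of cell g19** (−19/13 ⊗ χ₋₄₂ (w6 g19, p745174); `N = 504452265408`; additive odd primes `[3, 7, 269]`, multiplicative `[13, 19]`): for every `U`, `¬ TwoStepAt 13 U E′` — UNCONDITIONAL.
[cite: GrossLMS1991, §1 (p. 235)] -/
theorem not_twoStepAt_into_e13b10 (U : WeierstrassCurve ℚ) : ¬ TwoStepAt 13 U (⟨0, 0, 0, -520366084299684, -4568899355131477948722⟩ : WeierstrassCurve ℚ) := by
  haveI := EisensteinPrimesMazurMCOnCellBKernelCertP13NoUnitVertex.isElliptic_e13b10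
  obtain ⟨h2, hps, hcover, hpsm⟩ := reverseData_e13b10
  exact not_twoStepAt_into_of_check _ _ (by decide) h2 hps hcover hpsm check_e13a10 U

end Summit.BirchSwinnertonDyer.BirchSwinnertonDyer.Theorems.EisensteinPrimesMazurMCOnCellBKernelCertP13NoReverseEdge
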